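import Literature.AlgebraicGeometry.Motives.KaehlerTopology
import Literature.Geometry.Kaehler.KaehlerProofs
import Literature.Geometry.Kaehler.ManifoldFormsChart
import Literature.Geometry.Manifold.OpenSubmanifoldTangent
import Literature.AlgebraicTopology.SingularHomology.SphereHomology
import Literature.AlgebraicTopology.SingularHomology.PuncturedEuclidean
import Mathlib.Analysis.InnerProductSpace.Basic
import Mathlib.Analysis.Complex.Basic
import HarnessLib

/-!
# The punctured plane: a non-compact Kähler manifold with `b₁ = 1`
(counterexample to the compactness-free form of `even_bettiNumber_of_odd`)

Sibling proof file of `Literature/AlgebraicGeometry/Motives/KaehlerTopology.lean`. The named fact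
`Literature.AlgebraicGeometry.Motives.even_bettiNumber_of_odd` ("odd Betti numbers of a compact
Kähler manifold are even", Hodge 1941; Voisin, *Hodge Theory and Complex Algebraic Geometry I*
(2002), §6.1.3, Cor. 6.13) was, as vendored until 2026-08-15, stated **without** the hypotheses
`[CompactSpace M] [T2Space M] [ConnectedSpace M]` of its section (a `def … : Prop` abstracts
only the section variables its body mentions; see the *Scope* and *false as stated* sections of
`KaehlerTopologyProofs.lean`). This file PROVES that that family is false, at the simplest
non-compact Kähler manifold with odd first Betti number, the punctured plane `ℂ ∖ {0}`
(`b₁ = 1`; compare Voisin's remark after Cor. 6.13, where `b₁ = 1` detects the *compact*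
non-Kähler Hopf surface). The refutation is stated in **unfolded form** — verbatim the instance
at `E = ℂ`, `M = ℂ ∖ {0}` of the body of the `def` as it then was — so that it does not depend on
the `def`, which the verdict clean-up (defact) pass of 2026-08-15 restates under the same name
with `[T2Space M] [CompactSpace M]` as instance binders of the `def` (the printed theorem); this
theorem stays as the record of why compactness is a binder:

* `isKaehlerManifold_opens_complex`: every open subset `U ⊆ ℂ`, as an open submanifold of the
  complex plane (Mathlib's `TopologicalSpace.Opens.instChartedSpace`, charts = restrictions of
  the identity chart), is a Kähler manifold in the sense of
  `Literature.Geometry.Kaehler.IsKaehlerManifold`: the flat metric `Re ⟪·, ·⟫` restricted to `U`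
  is a `C^∞` Riemannian metric (restriction of smooth bilinear sections to open submanifolds,
  `Literature.Geometry.Manifold.OpenSubmanifold.contMDiff_bilinSection`), Hermitian
  (`Literature.Geometry.Kaehler.re_inner_I_smul_I_smul`), and its Kähler form has constant
  coefficients in the (single) chart, hence is closed (`mextDeriv_eq_extDerivWithin`,
  `MForm.inChart_eq_of_mem_target`, `tangentCoordChange_self`). Voisin (2002), §3.1.3, p. 63
  (the flat metric of `ℂⁿ`, `ω = (i/2) Σ dzᵢ ∧ dz̄ᵢ`, is Kähler — and so is its restriction to
  any open subset); Griffiths–Harris (1978), p. 107.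
* `bettiNumber_one_puncturedPlane`: `b₁(ℂ ∖ {0}; ℚ) = 1`, from the tree's
  `homologyPuncturedTwoIso : H₁(ℝ² ∖ 0; M) ≅ M` (`SphereHomology.lean`, Hatcher 2002, Ex. 2.18 /
  Cor. 2.14 for `S¹ ≃ ℝ² ∖ 0`) transported along `ℂ ≃L[ℝ] ℝ²`
  (`Complex.equivRealProdCLM`, `ContinuousLinearEquiv.finTwoArrow`).
* `not_even_bettiNumber_of_odd_puncturedPlane :
    ¬ ∀ [IsKaehlerManifold ℂ ↥(ℂ ∖ {0})] {k : ℕ}, Odd k → Even (b_k(ℂ ∖ {0}; ℚ))` — **the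
  compactness-free family is false**: the punctured plane is a complex manifold modelled on `ℂ`
  carrying a Kähler metric, and its first Betti number is odd. Consequently no
  `even_bettiNumber_of_odd_holds` could have been proved for the family as first vendored; the
  printed theorem is its restriction to compact (Hausdorff) `M`, where it follows from the Hodge
  decomposition, de Rham's theorem and Hodge symmetry
  (`Literature.AlgebraicGeometry.Motives.even_bettiNumber_of_odd_of`, `KaehlerTopologyProofs.lean`),
  and which is what `even_bettiNumber_of_odd` states once `[T2Space M] [CompactSpace M]` are
  binders of the `def`.

Nothing is asserted: theorems only, no new definition or named fact; the punctured plane is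
written inline as the open set `(⟨{0}ᶜ, isOpen_compl_singleton⟩ : TopologicalSpace.Opens ℂ)`.

## References

* C. Voisin, *Hodge Theory and Complex Algebraic Geometry I*, CUP 2002, §3.1.3 (p. 63, flat
  Kähler metric), §6.1.3 Cor. 6.13 and the remark following it (PDF p. 121 of the held copy).
  [VoisinHodgeI2002]
* P. Griffiths, J. Harris, *Principles of Algebraic Geometry*, Wiley 1978, p. 107, p. 117.
  [GriffithsHarris1978]
* A. Hatcher, *Algebraic Topology*, CUP 2002, §2.2 Ex. 2.18, Cor. 2.14 (`H₁(ℝ² ∖ 0) ≅ ℤ`).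
  [HatcherAT2002]
* B. O'Neill, *Semi-Riemannian Geometry*, Academic Press 1983, Ch. 2, pp. 36–37 (restriction of
  tensor fields to open subsets). [ONeillSemiRiemannian1983]
-/

noncomputable section

open scoped Manifold ContDiff Topology
open Bundle TopologicalSpace Set CategoryTheory

namespace Literature.AlgebraicGeometry.Motives

open Literature.AlgebraicTopology.SingularHomology Literature.Geometry.Kaehler
  Literature.Geometry.Manifold

/-! ### Open subsets of `ℂ` are Kähler -/

/-- **Every open subset of the complex plane is a Kähler manifold.** For `U ⊆ ℂ` open, regarded
as an open submanifold of `ℂ` (charts the restrictions of the identity chart), the flat metric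
`g(v, w) = Re ⟪v, w⟫` on the (trivial) real tangent bundle of `U` is a `C^∞` Riemannian metric
— the restriction to `U` of the constant section on `ℂ`
(`Literature.Geometry.Kaehler.contMDiff_totalSpaceMk_bilin_const`,
`Literature.Geometry.Manifold.OpenSubmanifold.contMDiff_bilinSection`) — which is Hermitian
(`Re ⟪iv, iw⟫ = Re ⟪v, w⟫`) and whose Kähler form is closed: in the chart at any `x : U` its
representative is constant (the tangent coordinate changes of `U` are identities,
`tangentCoordChange_self`, all charts of `U` being the same restricted identity chart), so its
exterior derivative `extDerivWithin` vanishes (`mextDeriv_eq_extDerivWithin`). Voisin (2002),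
§3.1.3, p. 63 (the flat metric `ω = (i/2) Σ dzᵢ ∧ dz̄ᵢ` of `ℂⁿ` is Kähler; closedness and the
Hermitian condition are local, so they persist on open subsets); Griffiths–Harris (1978),
p. 107. [cite: VoisinHodgeI2002, §3.1.3 p. 63] -/
theorem isKaehlerManifold_opens_complex (U : Opens ℂ) : IsKaehlerManifold ℂ U := by
  let B : ℂ →L[ℝ] ℂ →L[ℝ] ℝ := innerSL ℝ (E := ℂ)
  let g : ContMDiffRiemannianMetric 𝓘(ℝ, ℂ) ∞ ℂ (fun x : U ↦ TangentSpace 𝓘(ℝ, ℂ) x) :=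
    { inner := fun _ ↦ B
      symm := fun _ v w ↦ by
        change inner ℝ (show ℂ from v) (show ℂ from w) = inner ℝ (show ℂ from w) (show ℂ from v)
        exact real_inner_comm _ _
      pos := fun _ v hv ↦ by
        change 0 < inner ℝ (show ℂ from v) (show ℂ from v)
        exact real_inner_self_pos.2 hv
      isVonNBounded := fun _ ↦ by
        change Bornology.IsVonNBounded ℝ {v : ℂ | inner ℝ v v < 1}
        refine (NormedSpace.isVonNBounded_ball ℝ ℂ 1).subset ?_
        intro v hv
        rw [mem_setOf_eq, real_inner_self_eq_norm_sq] at hv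
        rw [Metric.mem_ball, dist_zero_right]
        nlinarith [norm_nonneg v]
      contMDiff := OpenSubmanifold.contMDiff_bilinSection (I := 𝓘(ℝ, ℂ)) (s := fun _ : ℂ ↦ B)
        (contMDiff_totalSpaceMk_bilin_const B) U }
  refine ⟨⟨g, fun x v w ↦ ?_, ?_⟩⟩
  · -- Hermitian: `Re ⟪iv, iw⟫ = Re ⟪v, w⟫`
    change RCLike.re (inner ℂ (Complex.I • (show ℂ from v)) (Complex.I • (show ℂ from w))) =
      RCLike.re (inner ℂ (show ℂ from v) (show ℂ from w))
    exact re_inner_I_smul_I_smul _ _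
  · -- closed: the representative of the Kähler form in the chart at `x` is constant
    set α := g.toRiemannianMetric.kaehlerForm with hα
    funext x
    have hin : ∀ y ∈ (extChartAt 𝓘(ℝ, ℂ) x).target, α.inChart x y = α x := by
      intro y hy
      rw [MForm.inChart_eq_of_mem_target α hy]
      set z := (extChartAt 𝓘(ℝ, ℂ) x).symm y with hz
      have hcc : ∀ w : ℂ, tangentCoordChange 𝓘(ℝ, ℂ) x z z w = w := fun w ↦ by
        change tangentCoordChange 𝓘(ℝ, ℂ) z z z w = w
        exact tangentCoordChange_self (mem_extChartAt_source z)
      ext v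
      rw [ContinuousAlternatingMap.compContinuousLinearMap_apply]
      change α x (fun i ↦ tangentCoordChange 𝓘(ℝ, ℂ) x z z (v i)) = α x v
      congr 1
      funext i
      exact hcc (v i)
    have hev : α.inChart x =ᶠ[𝓝 (extChartAt 𝓘(ℝ, ℂ) x x)] fun _ ↦ α x := by
      filter_upwards [(isOpen_extChartAt_target (I := 𝓘(ℝ, ℂ)) x).mem_nhds
        (mem_extChartAt_target (I := 𝓘(ℝ, ℂ)) x)] with y hy
      exact hin y hy
    rw [mextDeriv_eq_extDerivWithin,
      (hev.filter_mono nhdsWithin_le_nhds).extDerivWithin_eq (hin _ (mem_extChartAt_target x)),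
      extDerivWithin, fderivWithin_const_apply,
      ← ContinuousAlternatingMap.alternatizeUncurryFinCLM_apply, map_zero]
    rfl

/-! ### The punctured plane `ℂ ∖ {0}` -/

/-- **`b₁(ℂ ∖ {0}; ℚ) = 1`** (Hatcher 2002, §2.2 Ex. 2.18 / Cor. 2.14: `H₁(ℝ² ∖ 0) ≅ H₁(S¹) ≅ ℤ`,
here with field coefficients): the punctured plane, as the open subset `{0}ᶜ` of `ℂ`, is
homeomorphic to the tree's punctured `ℝ²` (`punctured 2 ⊆ Fin 2 → ℝ`) along
`ℂ ≃L[ℝ] ℝ × ℝ ≃L[ℝ] (Fin 2 → ℝ)` (`Complex.equivRealProdCLM`, `ContinuousLinearEquiv.finTwoArrow`,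
`complSingletonHomeomorph`), whose first homology is the coefficient module
(`homologyPuncturedTwoIso`, `SphereHomology.lean`). PROVED. [cite: HatcherAT2002, §2.2 Ex. 2.18 and Cor. 2.14] -/
theorem bettiNumber_one_puncturedPlane :
    bettiNumber ℚ (↥((⟨({0} : Set ℂ)ᶜ, isOpen_compl_singleton⟩ : Opens ℂ))) 1 = 1 := by
  let e : ℂ ≃L[ℝ] (Fin 2 → ℝ) :=
    Complex.equivRealProdCLM.trans (ContinuousLinearEquiv.finTwoArrow ℝ ℝ).symm
  let h₁ : (↥((⟨({0} : Set ℂ)ᶜ, isOpen_compl_singleton⟩ : Opens ℂ))) ≃ₜ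
      ↥({(0 : RVec 2)}ᶜ : Set (RVec 2)) :=
    e.toHomeomorph.subtype fun x ↦ by
      change x ∈ ({0}ᶜ : Set ℂ) ↔ e x ∈ ({0}ᶜ : Set (RVec 2))
      simp only [mem_compl_iff, mem_singleton_iff, e.map_eq_zero_iff]
  let h := h₁.trans (complSingletonHomeomorph (0 : RVec 2))
  have iso : singularHomology ℚ ℚ (↥((⟨({0} : Set ℂ)ᶜ, isOpen_compl_singleton⟩ : Opens ℂ))) 1 ≅
      ModuleCat.of ℚ ℚ :=
    singularHomology.mapIso ℚ ℚ h 1 ≪≫ (csingularHomology.compIso ℚ ℚ _ 1).symm ≪≫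
      homologyPuncturedTwoIso ℚ ℚ
  change Module.finrank ℚ (singularHomology ℚ ℚ _ 1) = 1
  rw [iso.toLinearEquiv.finrank_eq, Module.finrank_self]

/-- **"Odd Betti numbers of a Kähler manifold are even" is false without compactness.** The
punctured plane `ℂ ∖ {0}` — the open submanifold `{0}ᶜ` of `ℂ`, a complex manifold modelled on
`ℂ` (`IsManifold 𝓘(ℂ, ℂ) ω`) with a Kähler metric (`isKaehlerManifold_opens_complex`) — has
`b₁ = 1` (`bettiNumber_one_puncturedPlane`), an odd first Betti number. The statement refuted is,
verbatim, the instance at `E = ℂ`, `M = ℂ ∖ {0}` of the body of the named fact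
`Literature.AlgebraicGeometry.Motives.even_bettiNumber_of_odd` as vendored until 2026-08-15 —
without the compactness hypothesis of its section (cf. the *Correction*/*Scope* notes of the
sibling files) — kept in this unfolded form as the record of why that fact now carries
`[T2Space M] [CompactSpace M]` as binders of the `def` (verdict clean-up, 2026-08-15); it fails
at `k = 1`. The printed theorem (Hodge 1941; Voisin 2002, Cor. 6.13: "The odd Betti numbers of a
**compact** Kähler manifold are even") is untouched: compactness is essential, exactly as
Voisin's remark after Cor. 6.13 uses `b₁ = 1` to detect a non-Kähler compact surface. PROVED (no
hypotheses). [cite: VoisinHodgeI2002, §6.1.3 Cor. 6.13 and the following remark] -/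
theorem not_even_bettiNumber_of_odd_puncturedPlane :
    ¬ ∀ [IsKaehlerManifold ℂ (↥((⟨({0} : Set ℂ)ᶜ, isOpen_compl_singleton⟩ : Opens ℂ)))] {k : ℕ},
      Odd k → Even (bettiNumber ℚ (↥((⟨({0} : Set ℂ)ᶜ, isOpen_compl_singleton⟩ : Opens ℂ))) k) := by
  intro h
  haveI := isKaehlerManifold_opens_complex ((⟨({0} : Set ℂ)ᶜ, isOpen_compl_singleton⟩ : Opens ℂ))
  have h1 : Even (bettiNumber ℚ (↥((⟨({0} : Set ℂ)ᶜ, isOpen_compl_singleton⟩ : Opens ℂ))) 1) :=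
    h odd_one
  rw [bettiNumber_one_puncturedPlane] at h1
  exact Nat.not_even_one h1

end Literature.AlgebraicGeometry.Motives
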